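import Summits.QuantumFields.YangMills.Theorems.UnitScaleTiltProp7TopMeanBlockLocal
import HarnessLib

/-!
# Route `UnitScaleTilt`, crux «MinimiserStabilityRegPr» (stmt-QuantumFields-19200, stub EX), positivity block, the LOD ∕ Combes–Thomas line (★p1 g24 `LOCATE-P349-CT` v2 §7 (E2);
# ★★OWNER RULINGS №33 ∕ №34; chair word 21:49:33Z «px17 g8 ← (L2′)») — **THE ADJOINT OF THE TOP NESTED COVARIANT MEAN IS BLOCK-LOCAL: for ANY sitewise coarse pairing and ANY
# adjoint `T` of `Q″` in the hypothesis-form `⟪Q″λ, c⟫ = ⟪λ, Tc⟫` of ✓`Prop7LODProjectorGlue`, the columns `Q″†e_y` are supported in the block `B^{K−n}(y)`, `Q″†Q″` commutes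
# with every block cut, and `Q″†Q″` commutes EXACTLY with every block-constant multiplier** (width seat `ym3-torus-px17` gen 8, 2026-08-29; brick (L2′-adj) of the chair's split)

Cell `ym3-torus` (HUMAN RULING D-0037: YM₃ on T³ is ladder rung R3 — NOT d = 4, NOT infinite volume, NOT a mass gap, NOT Clay).  THEOREMS ONLY (0 `def`, 0 `sorry`);
`--supports stmt-QuantumFields-19200 --as helper`, count-neutral.  HONEST LABEL (№33 (6) ∕ №34): a structural letter of the curved γ-row supplier line (LOD localisation; «no
RANDOM-WALK organ; ONE Thm 3.1-class Agmon brick (L3′) inside, Track A road cited»); nothing of (L2′)-GAP, (BUMP), (L3′)–(L5′), [Balaban1985BackgroundPropagators] (3.49), Thm 3.1 ∕ 3.3,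
`h349`, `hGF`, EX or the crux is proved here.

THE POINT.  Memo §7 (E2) writes print's projector as `P = 1 − R = B_a M⁻¹ B_a†`, `B_a := G_a Q″†` (columns `G_aQ″†e_y`), `M := Q″G_a²Q″†`; ✓`Prop7LODProjectorGlue` (p747104) types this
with the coarse pairing left OPEN: `T` is an adjoint of `Q` by HYPOTHESIS `⟪Qλ, c⟫ = ⟪λ, Tc⟫`.  The LOCALITY in `y` of that assembly, the vanishing `[Q″†Q″, e^{μφ}] = 0` for block-constant
Agmon weights in (L3′) (basis (i) of ✓`Prop7CorrectorAgmonDecay`: the `√a·Q″` summand contributes NO `K₁`-defect), and the block structure of ✓`Prop7ProjRangeKernelDecayCoarseGram`'s `B`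
all come from ONE fact: `Q″†e_y` is supported in `B^{K−n}(y)`.  This file proves it from ✓`Prop7TopMeanBlockLocal.topMean_cut` (p747168: the top mean of a block piece is concentrated
at its block) for EVERY coarse pairing that is SITEWISE — any `ℂ`-linear reading `ι` of the coarse sections into an inner-product space with `⟪ι c, ι c′⟫ = 0` whenever `c`, `c′` have
disjoint supports (§1: the lane's block-constant lift `c ↦ toL2S F n c₁ (c ∘ siteShift)` of ✓`Prop7BlockBumpExtension` ∕ px5's GAP display is one) — and EVERY `T` with
`⟪ι(Q″λ), f⟫ = ⟪λ, Tf⟫` (§1: `LinearMap.adjoint (ι ∘ Q″)` is one).  Method: spike tests — `⟪toL2S(δ_x⊗A), T(ιc)⟫ = ⟪ι(Q″(toL2S(δ_x⊗A))), ιc⟫` and `Q″(toL2S(δ_x⊗A))` is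
concentrated at the block of `x` (`topMean_cut`), so it pairs to `0` with any `c` supported at another coarse site; a vector pairing to `0` with every spike at `x` vanishes at `x` (§2).

WHAT IS PROVED (ns `…Theorems.Prop7TopMeanAdjointBlockLocal`; T³ member, weight `c₀`; `Q''` ANY linear map with clause (iv) of ✓`exists_intertwiner_of_regPr` — the `hseq` of
✓p746531 ∕ ✓p747168 VERBATIM; `ι`, `T` as above).
* §1 `inner_blockLift_eq_zero_of_disjoint` (the block-constant lift is sitewise) · `inner_adjoint_comp` (`LinearMap.adjoint (ι ∘ₗ Q'')` satisfies `hT`).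
* §2 `inner_toL2S_single_left` (`⟪toL2S(δ_x⊗A), toL2S g⟫ = c₀·tr(Aᴴ g(x))`) · `apply_eq_zero_of_inner_single_eq_zero` (spike test) · `topMean_toL2S_single_eq` (`Q''(toL2S(δ_x⊗A))` is
  `Pi.single (iterBlockOf (K−n) x) _`).
* §3 ★★★`adjoint_apply_eq_zero_off_block` (`c` supported at `{y}` ⟹ `T(ιc)` vanishes off `B^{K−n}(y)`) · ★★`inner_adjoint_eq_zero_of_support` · ★★★`adjoint_topMean_cut_comm`
  (`T(ι(Q''(toL2S(𝟙_{B(y)}λ)))) = 𝟙_{B(y)}·T(ι(Q''(toL2S λ)))`) · ★★`adjoint_topMean_blockConst_comm` (`Q″†Q″` commutes with `φ ∘ iterBlockOf (K−n)` for every `φ`).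
HONEST SCOPE.  Bookkeeping over ✓p747168; no estimate, no decay, no choice of the coarse weight imposed; nothing continuum ∕ OS ∕ mass-gap ∕ Clay.

References: T. Bałaban, CMP **99** (1985) 389–434 [Balaban1985BackgroundPropagators] ((3.19) p.393, (3.21)–(3.25) p.394, (3.49) p.399, (3.114)–(3.115) p.418); CMP **95** (1984)
17–40 [Balaban1984PropagatorsI] ((1.16)–(1.18) p.20).
-/

set_option autoImplicit false

noncomputable section

open scoped BigOperators InnerProductSpace ComplexConjugate Matrix.Norms.L2Operator

namespace Summit.QuantumFields.YangMills.Theorems.Prop7TopMeanAdjointBlockLocal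

open Literature.MathematicalPhysics.QuantumFieldTheory.Balaban1983to89
open Literature.MathematicalPhysics.QuantumFieldTheory.Balaban1983to89.T3ContinuumYM3Torus
open T4Continuum BlockAveraging
open BlockAveraging (Idx)
open B7Prop1Explicit (disp)
open B10Eq27TorusAxialLog (holT transl)
open B7TransferAnalyticMean (meanCLM)
open B9Eq311L2Pairing (WL2)
open B11Eq103H1Complex (SiteL2K)
open B5Eq118OneStroke (iterBlockOf)
open T3PrintedRegularOrbits (sites_eq)
open T3LevelShift (siteShift)
open T3SectALandauChart (bgUnits)
open Summit.QuantumFields.YangMills.Theorems.Prop8Chart (emlIterU)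
open Summit.QuantumFields.YangMills.Theorems.Prop7SectET3Transport (periodsT3)
open Summit.QuantumFields.YangMills.Theorems.Prop7SectET3HilbertLetters (W₂ toL2S)
open Summit.QuantumFields.YangMills.Theorems.Prop7SectET3RealCoordSums (inner_toL2S)
open Summit.QuantumFields.YangMills.Theorems.Prop7TopMeanBlockLocal (topMean_cut)

variable (F : T3Family) {n K : ℕ} {c₀ : ℝ} [Fact (0 < c₀)]

/-! ## §1 Two inhabitants of the hypotheses: the block-constant lift is sitewise; the Hilbert adjoint is an adjoint -/

/-- **THE LANE'S BLOCK-CONSTANT LIFT IS A SITEWISE PAIRING**: reading coarse sections through `c ↦ toL2S F n c₁ (c ∘ siteShift)` (✓`Prop7BlockBumpExtension.normSq_toL2S_comp_siteShift_eq`;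
weight `c₁`, e.g. `c₀η⁻³`), sections with disjoint supports are orthogonal. [cite: Balaban1985BackgroundPropagators, (3.16) p.393] -/
theorem inner_blockLift_eq_zero_of_disjoint (h : n ≤ K) {c₁ : ℝ} [Fact (0 < c₁)] (c c' : Site (F.P K) (K - n) → Matrix (Fin 2) (Fin 2) ℂ)
    (hcc' : ∀ y, c y = 0 ∨ c' y = 0) :
    ⟪toL2S F n c₁ (fun z => c (siteShift (sites_eq F n K h) z)), toL2S F n c₁ (fun z => c' (siteShift (sites_eq F n K h) z))⟫_ℂ = 0 := by
  rw [inner_toL2S, Finset.sum_eq_zero, mul_zero]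
  intro z _
  rcases hcc' (siteShift (sites_eq F n K h) z) with h0 | h0
  · rw [h0, Matrix.conjTranspose_zero, Matrix.zero_mul, Matrix.trace_zero]
  · rw [h0, Matrix.mul_zero, Matrix.trace_zero]

/-- **THE HILBERT ADJOINT IS AN ADJOINT IN THE HYPOTHESIS-FORM**: for any reading `ι` into a finite-dimensional inner-product space, `T := (ι ∘ Q'')†` satisfies `⟪ι(Q''λ), f⟫ = ⟪λ, Tf⟫`
(the `hT` of ✓`Prop7LODProjectorGlue` and of §3). [cite: Balaban1985BackgroundPropagators, (3.16) p.393] -/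
theorem inner_adjoint_comp {Fc : Type*} [NormedAddCommGroup Fc] [InnerProductSpace ℂ Fc] [FiniteDimensional ℂ Fc]
    (Q'' : SiteL2K ℂ 3 (periodsT3 F K) c₀ W₂ →ₗ[ℂ] (Site (F.P K) (K - n) → Matrix (Fin 2) (Fin 2) ℂ))
    (ι : (Site (F.P K) (K - n) → Matrix (Fin 2) (Fin 2) ℂ) →ₗ[ℂ] Fc) (l : SiteL2K ℂ 3 (periodsT3 F K) c₀ W₂) (f : Fc) :
    ⟪ι (Q'' l), f⟫_ℂ = ⟪l, LinearMap.adjoint (ι ∘ₗ Q'') f⟫_ℂ := by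
  rw [LinearMap.adjoint_inner_right]; rfl

/-! ## §2 Spike tests in the weighted `L²` of the gauge parameters -/

/-- `⟪toL2S(δ_x⊗A), toL2S g⟫ = c₀·tr(Aᴴ·g(x))` (✓`inner_toL2S` at a spike). [cite: Balaban1985BackgroundPropagators, (3.11) p.392] -/
theorem inner_toL2S_single_left (x : Site (F.P K) 0) (A : Matrix (Fin 2) (Fin 2) ℂ) (g : Site (F.P K) 0 → Matrix (Fin 2) (Fin 2) ℂ) :
    ⟪toL2S F K c₀ (Pi.single x A), toL2S F K c₀ g⟫_ℂ = (c₀ : ℂ) * Matrix.trace (A.conjTranspose * g x) := by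
  rw [inner_toL2S, Finset.sum_eq_single x]
  · rw [Pi.single_eq_same]
  · intro z _ hz; rw [Pi.single_eq_of_ne hz, Matrix.conjTranspose_zero, Matrix.zero_mul, Matrix.trace_zero]
  · intro hx; exact absurd (Finset.mem_univ x) hx

/-- **SPIKE TEST**: a vector of `SiteL2K` orthogonal to every spike `toL2S(δ_x⊗A)` at `x` vanishes at `x` (read back on the route's functions). [cite: Balaban1985BackgroundPropagators, (3.11) p.392] -/
theorem apply_eq_zero_of_inner_single_eq_zero (v : SiteL2K ℂ 3 (periodsT3 F K) c₀ W₂) (x : Site (F.P K) 0)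
    (hv : ∀ A : Matrix (Fin 2) (Fin 2) ℂ, ⟪toL2S F K c₀ (Pi.single x A), v⟫_ℂ = 0) : (toL2S F K c₀).symm v x = 0 := by
  obtain ⟨g, rfl⟩ : ∃ g : Site (F.P K) 0 → Matrix (Fin 2) (Fin 2) ℂ, v = toL2S F K c₀ g := ⟨(toL2S F K c₀).symm v, ((toL2S F K c₀).apply_symm_apply v).symm⟩
  rw [LinearEquiv.symm_apply_apply]
  -- the spike `δ_x ⊗ g(x)` pairs with `g` as with itself
  have hself : ⟪toL2S F K c₀ (Pi.single x (g x)), toL2S F K c₀ (Pi.single x (g x))⟫_ℂ = ⟪toL2S F K c₀ (Pi.single x (g x)), toL2S F K c₀ g⟫_ℂ := by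
    rw [inner_toL2S_single_left, inner_toL2S_single_left, Pi.single_eq_same]
  have h0 : toL2S F K c₀ (Pi.single x (g x)) = 0 := by
    rw [← inner_self_eq_zero (𝕜 := ℂ), hself, hv]
  have h1 : Pi.single x (g x) = (0 : Site (F.P K) 0 → Matrix (Fin 2) (Fin 2) ℂ) := (toL2S F K c₀).injective (by rw [h0, map_zero])
  simpa using congrFun h1 x

section Member

variable (U₀ : GaugeField (F.P K) 0 (Matrix.specialUnitaryGroup (Fin 2) ℂ))
  (Q'' : SiteL2K ℂ 3 (periodsT3 F K) c₀ W₂ →ₗ[ℂ] (Site (F.P K) (K - n) → Matrix (Fin 2) (Fin 2) ℂ))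
  (hseq : ∀ lam : Site (F.P K) 0 → Matrix (Fin 2) (Fin 2) ℂ, ∃ ns : (j : ℕ) → Site (F.P K) j → Matrix (Fin 2) (Fin 2) ℂ, ns 0 = lam ∧
      (∀ (j : ℕ) (y : Site (F.P K) (j + 1)), ns (j + 1) y = ns j (emb y) - meanCLM (Idx (F.P K)) (Matrix (Fin 2) (Fin 2) ℂ) fun i : Idx (F.P K) =>
        ns j (emb y) - ((holT (emlIterU j (bgUnits F K U₀)) (emb y) (stairWord i.2.1 (off i.1)) : (Matrix (Fin 2) (Fin 2) ℂ)ˣ) : Matrix (Fin 2) (Fin 2) ℂ) *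
          ns j (transl (emb y) (disp (stairWord i.2.1 (off i.1)))) * (((holT (emlIterU j (bgUnits F K U₀)) (emb y) (stairWord i.2.1 (off i.1)))⁻¹ : (Matrix (Fin 2) (Fin 2) ℂ)ˣ) : Matrix (Fin 2) (Fin 2) ℂ)) ∧
      ns (K - n) = Q'' (toL2S F K c₀ lam))

include hseq

omit [Fact (0 < c₀)] in
/-- **THE TOP MEAN OF A SPIKE IS CONCENTRATED AT ITS BLOCK**: `Q''(toL2S(δ_x⊗A)) = Pi.single (iterBlockOf (K−n) x) ((Q''(toL2S(δ_x⊗A))) (iterBlockOf (K−n) x))` (✓`topMean_cut` at a spike,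
which is its own block cut). [cite: Balaban1985BackgroundPropagators, (3.19) p.393; Balaban1984PropagatorsI, (1.18) p.20] -/
theorem topMean_toL2S_single_eq (x : Site (F.P K) 0) (A : Matrix (Fin 2) (Fin 2) ℂ) :
    Q'' (toL2S F K c₀ (Pi.single x A)) = Pi.single (iterBlockOf (K - n) x) (Q'' (toL2S F K c₀ (Pi.single x A)) (iterBlockOf (K - n) x)) := by
  have hcut : (Pi.single x A : Site (F.P K) 0 → Matrix (Fin 2) (Fin 2) ℂ)
      = fun z => if iterBlockOf (K - n) z = iterBlockOf (K - n) x then (Pi.single x A : Site (F.P K) 0 → Matrix (Fin 2) (Fin 2) ℂ) z else 0 := by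
    funext z
    by_cases hz : z = x
    · subst hz; rw [if_pos rfl]
    · rw [Pi.single_eq_of_ne hz]; split_ifs <;> rfl
  conv_lhs => rw [hcut]
  rw [topMean_cut F U₀ Q'' hseq]

variable {Fc : Type*} [NormedAddCommGroup Fc] [InnerProductSpace ℂ Fc]
  (ι : (Site (F.P K) (K - n) → Matrix (Fin 2) (Fin 2) ℂ) →ₗ[ℂ] Fc)
  (hι : ∀ c c' : Site (F.P K) (K - n) → Matrix (Fin 2) (Fin 2) ℂ, (∀ y, c y = 0 ∨ c' y = 0) → ⟪ι c, ι c'⟫_ℂ = 0)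
  (T : Fc →ₗ[ℂ] SiteL2K ℂ 3 (periodsT3 F K) c₀ W₂)
  (hT : ∀ (l : SiteL2K ℂ 3 (periodsT3 F K) c₀ W₂) (f : Fc), ⟪ι (Q'' l), f⟫_ℂ = ⟪l, T f⟫_ℂ)

include hι hT

/-! ## §3 The adjoint is block-local -/

/-- ★★★ **THE COLUMNS `Q″†e_y` ARE BLOCK-SUPPORTED**: for every sitewise reading `ι` and every adjoint `T` of `ι ∘ Q''` in hypothesis-form, a coarse section `c` supported at the single coarse
site `y` has `T(ιc)` supported in the block `B^{K−n}(y)` — the locality in `y` of memo (E2)'s assembly `P(x,x′) = Σ_{y,y′}(G_aQ″†e_y)(x)·M⁻¹(y,y′)·(G_aQ″†e_{y′})(x′)` and the block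
structure of ✓`Prop7ProjRangeKernelDecayCoarseGram`'s `B`. [cite: Balaban1985BackgroundPropagators, (3.21)-(3.25) p.394, (3.49) p.399] -/
theorem adjoint_apply_eq_zero_off_block (c : Site (F.P K) (K - n) → Matrix (Fin 2) (Fin 2) ℂ) (y : Site (F.P K) (K - n)) (hc : ∀ y', y' ≠ y → c y' = 0)
    (x : Site (F.P K) 0) (hx : iterBlockOf (K - n) x ≠ y) : (toL2S F K c₀).symm (T (ι c)) x = 0 := by
  refine apply_eq_zero_of_inner_single_eq_zero F _ x fun A => ?_
  rw [← hT, topMean_toL2S_single_eq F U₀ Q'' hseq x A]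
  refine hι _ _ fun y' => ?_
  by_cases hy' : y' = y
  · subst hy'; exact Or.inl (Pi.single_eq_of_ne (Ne.symm hx) _)
  · exact Or.inr (hc y' hy')

/-- ★★ **OFF-BLOCK PAIRINGS WITH A COLUMN VANISH**: `c` supported at `{y}`, `λ'` supported off `B^{K−n}(y)` ⟹ `⟪toL2S λ', T(ιc)⟫ = 0`. [cite: Balaban1985BackgroundPropagators, (3.21)-(3.25) p.394] -/
theorem inner_adjoint_eq_zero_of_support (c : Site (F.P K) (K - n) → Matrix (Fin 2) (Fin 2) ℂ) (y : Site (F.P K) (K - n)) (hc : ∀ y', y' ≠ y → c y' = 0)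
    (lam' : Site (F.P K) 0 → Matrix (Fin 2) (Fin 2) ℂ) (hlam' : ∀ x : Site (F.P K) 0, iterBlockOf (K - n) x = y → lam' x = 0) :
    ⟪toL2S F K c₀ lam', T (ι c)⟫_ℂ = 0 := by
  obtain ⟨g, hg⟩ : ∃ g : Site (F.P K) 0 → Matrix (Fin 2) (Fin 2) ℂ, T (ι c) = toL2S F K c₀ g := ⟨(toL2S F K c₀).symm (T (ι c)), ((toL2S F K c₀).apply_symm_apply _).symm⟩
  have hg0 : ∀ x : Site (F.P K) 0, iterBlockOf (K - n) x ≠ y → g x = 0 := fun x hx => by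
    have h := adjoint_apply_eq_zero_off_block F U₀ Q'' hseq ι hι T hT c y hc x hx
    rwa [hg, LinearEquiv.symm_apply_apply] at h
  rw [hg, inner_toL2S, Finset.sum_eq_zero, mul_zero]
  intro x _
  by_cases hx : iterBlockOf (K - n) x = y
  · rw [hlam' x hx, Matrix.conjTranspose_zero, Matrix.zero_mul, Matrix.trace_zero]
  · rw [hg0 x hx, Matrix.mul_zero, Matrix.trace_zero]

/-- ★★★ **`Q″†Q″` COMMUTES WITH BLOCK CUTS**: `T(ι(Q''(toL2S(𝟙_{B(y)}·λ)))) = 𝟙_{B(y)}·T(ι(Q''(toL2S λ)))` read back on the sites — `Q″†Q″` is block-diagonal for every sitewise pairing.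
[cite: Balaban1985BackgroundPropagators, (3.21)-(3.25) p.394, (3.49) p.399; Balaban1984PropagatorsI, (1.18) p.20] -/
theorem adjoint_topMean_cut_comm (lam : Site (F.P K) 0 → Matrix (Fin 2) (Fin 2) ℂ) (y : Site (F.P K) (K - n)) :
    T (ι (Q'' (toL2S F K c₀ fun x => if iterBlockOf (K - n) x = y then lam x else 0)))
      = toL2S F K c₀ fun x => if iterBlockOf (K - n) x = y then (toL2S F K c₀).symm (T (ι (Q'' (toL2S F K c₀ lam)))) x else 0 := by
  rw [topMean_cut F U₀ Q'' hseq]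
  generalize Q'' (toL2S F K c₀ lam) = q
  -- decompose `q` into its single-site pieces
  have hq : q = ∑ y' : Site (F.P K) (K - n), Pi.single y' (q y') := (Finset.univ_sum_single q).symm
  have hoff : ∀ (y' : Site (F.P K) (K - n)) (x : Site (F.P K) 0), iterBlockOf (K - n) x ≠ y' →
      (toL2S F K c₀).symm (T (ι (Pi.single y' (q y')))) x = 0 := fun y' x hx =>
    adjoint_apply_eq_zero_off_block F U₀ Q'' hseq ι hι T hT _ y' (fun y'' hy'' => Pi.single_eq_of_ne hy'' _) x hx
  apply (toL2S F K c₀).symm.injective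
  rw [LinearEquiv.symm_apply_apply]
  funext x
  by_cases hx : iterBlockOf (K - n) x = y
  · rw [if_pos hx]
    conv_rhs => rw [hq, map_sum, map_sum, map_sum, Finset.sum_apply]
    rw [Finset.sum_eq_single y]
    · intro y' _ hy'; exact hoff y' x (by rw [hx]; exact Ne.symm hy')
    · intro hy; exact absurd (Finset.mem_univ y) hy
  · rw [if_neg hx]
    exact hoff y x hx

/-- ★★ **`Q″†Q″` COMMUTES EXACTLY WITH EVERY BLOCK-CONSTANT MULTIPLIER**: for every `φ` on the coarse sites, `T(ι(Q''(toL2S((φ ∘ iterBlockOf)·λ)))) = (φ ∘ iterBlockOf)·T(ι(Q''(toL2S λ)))`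
— so the Agmon weight `e^{μφ}` with BLOCK-CONSTANT `φ` produces NO commutator with the mass term `aQ″†Q″` of memo (E2)'s `Δ_U + aQ″†Q″` ((L3′); basis (i) of ✓`Prop7CorrectorAgmonDecay`).
[cite: Balaban1985BackgroundPropagators, (3.24)-(3.25) p.394, (3.49) p.399] -/
theorem adjoint_topMean_blockConst_comm (φ : Site (F.P K) (K - n) → ℂ) (lam : Site (F.P K) 0 → Matrix (Fin 2) (Fin 2) ℂ) :
    T (ι (Q'' (toL2S F K c₀ fun x => φ (iterBlockOf (K - n) x) • lam x)))
      = toL2S F K c₀ fun x => φ (iterBlockOf (K - n) x) • (toL2S F K c₀).symm (T (ι (Q'' (toL2S F K c₀ lam)))) x := by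
  -- a block-constant multiple is a combination of block cuts
  have hdec : ∀ g : Site (F.P K) 0 → Matrix (Fin 2) (Fin 2) ℂ,
      (fun x => φ (iterBlockOf (K - n) x) • g x) = ∑ y : Site (F.P K) (K - n), φ y • fun x => if iterBlockOf (K - n) x = y then g x else 0 := by
    intro g
    funext x
    rw [Finset.sum_apply, Finset.sum_eq_single (iterBlockOf (K - n) x)]
    · rw [Pi.smul_apply, if_pos rfl]
    · intro y _ hy; rw [Pi.smul_apply, if_neg (Ne.symm hy), smul_zero]
    · intro h; exact absurd (Finset.mem_univ _) h
  rw [hdec lam, hdec, map_sum, map_sum, map_sum, map_sum, map_sum]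
  refine Finset.sum_congr rfl fun y _ => ?_
  rw [map_smul, map_smul, map_smul, map_smul, map_smul, adjoint_topMean_cut_comm F U₀ Q'' hseq ι hι T hT lam y]

end Member

end Summit.QuantumFields.YangMills.Theorems.Prop7TopMeanAdjointBlockLocal

end
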